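import Summits.CriticalPhenomena.PercolationContinuityZ3.Theorems.PercGamblersRuinVerticalGamblersRuinStubCoreOfVGR

/-!
# `stub_reflectedComplement` of line `registered` (crux `VerticalGamblersRuin`, stmt-CriticalPhenomena-10642):
# the reflected lopsided voltage is the complementary exit mass

Route `PercGamblersRuin` of `PercolationContinuityZ3`, skeleton rev 7 (the deterministic-time criterion) of
the line `registered` (`Cruxes/VerticalGamblersRuin/Lines/birth.lean`), stub `stub_reflectedComplement`.

Setting: bond configurations `ω` on `ℤ³` under `P = P_{p_c}`; `deg_ω(0)` is the number of lattice
neighbours `y ∼ 0` with `s(0, y)` open in `ω`.  For `K, n ≥ 1` let `v` be a selection of voltages of the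
slab `S = {-Kn < x₀ < (K+1)n}` (`= 1` on `{x₀ ≥ (K+1)n}`, `= 0` on `{x₀ ≤ -Kn}`, harmonic for the open
lattice edges of `ω` at every site of `S`) and `w` a selection of voltages of the REFLECTED slab
`S' = {-(K+1)n < x₀ < Kn}` (`= 1` on `{x₀ ≥ Kn}`, `= 0` on `{x₀ ≤ -(K+1)n}`, harmonic on `S'`), both
measurable at `0`.

Statement proved (exact registered signature):
`∫_{0↔∞} deg_ω(0) · w(ω,0) dP = ∫_{0↔∞} deg_ω(0) · (1 - v(ω,0)) dP`.

Proof (adaptation of `StubCoreOfVGR.setIntegral_symm_eq` to an asymmetric slab and the weight `deg`).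
Let `r : x₀ ↦ -x₀` be the reflection (`Site.signedPerm`, a lattice automorphism fixing `0`) and
`R = BondConfig.relabel (sym2Equiv r)` the induced relabelling of configurations.
* `P` is `R`-invariant (`bondPercolation_map_relabel_iso`) and `R ⁻¹' {0↔∞} = {0↔∞}`
  (`relabel_mem_percolatesAt_iff`), so `∫_{0↔∞} deg_ω(0) w(ω,0) dP = ∫_{0↔∞} deg_{Rω}(0) w(Rω,0) dP`
  (`MeasurePreserving.setIntegral_preimage_emb`).
* `deg_{Rω}(0) = deg_ω(0)` (`card_filter_relabel`: `y ↦ r y` is a bijection of the open neighbours).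
* For `P`-a.e. `ω ∈ {0↔∞}` one has `v(ω,0) = 1 - w(Rω,0)` (`eq_one_sub_reflect`): a.s. `ω ⊆ E(ℤ³)`
  (`setBernoulli_ae_subset`); a.s. `0` does not percolate inside the open slab `S` (it lies in the
  half-space `{x₀ ≥ -Kn}`, Barsky–Grimmett–Newman at `p_c(ℤ³)`,
  `FreeBoxSparse.StubCeiling.real_percolatesVia_halfSpace_depth`); and on this event `v(ω,·)` and
  `z ↦ 1 - w(Rω, r z)` agree off `S` (plate values: `r` maps `{x₀ ≤ -Kn}` into `{x₀ ≥ Kn}` and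
  `{x₀ ≥ (K+1)n}` into `{x₀ ≤ -(K+1)n}`) and are both harmonic on `S` for `ω` (`reflect_harmonic_of_mapsTo`,
  `r S = S'`), hence agree at `0 = r 0` by Dirichlet uniqueness on the finite slab piece
  (`SymmetricSlab.eq_of_harmonic`, maximum principle).
Hence the two restricted integrals coincide (`setIntegral_congr_ae`).

References: Lyons–Peres, *Probability on Trees and Networks* (2016), §2.1 (voltages, uniqueness);
Barsky–Grimmett–Newman (1991) (no percolation in half-spaces at `p_c`); Grimmett, *Percolation* (1999),
§1.6 (lattice symmetries of `P_p`).
-/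

noncomputable section

namespace Summit.CriticalPhenomena.PercolationContinuityZ3.Theorems.VerticalGamblersRuin

open MeasureTheory Filter Topology
open Literature.Probability.Percolation Literature.Probability.LatticeModels
open scoped Classical

namespace StubReflectedComplement

/-! ### Reflected voltages between two regions -/

/-- **Reflected voltages are harmonic (two regions).**  Let `r` be a lattice automorphism mapping the
region `S` into the region `S'` and `R = BondConfig.relabel (sym2Equiv r)` the induced relabelling of
configurations.  If `v'` is harmonic for the open lattice edges of `R ω` at every site of `S'`, then
`x ↦ 1 - v' (r x)` is harmonic for the open lattice edges of `ω` at every site of `S`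
(reindex the open neighbours of `x` in `ω` as the open neighbours of `r x` in `R ω`). -/
theorem reflect_harmonic_of_mapsTo {S S' : Set (Site 3)} (r : Site 3 ≃ Site 3)
    (hrS : ∀ x ∈ S, r x ∈ S') (hadj : ∀ x y, (zdGraph 3).Adj (r x) (r y) ↔ (zdGraph 3).Adj x y)
    {ω : BondConfig (Site 3)} {v' : Site 3 → ℝ}
    (hharm' : ∀ x ∈ S', ∑ y ∈ ((zdGraph 3).neighborFinset x).filter
      (fun y => s(x, y) ∈ BondConfig.relabel (sym2Equiv r) ω), (v' y - v' x) = 0)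
    (x : Site 3) (hx : x ∈ S) :
    ∑ y ∈ ((zdGraph 3).neighborFinset x).filter (fun y => s(x, y) ∈ ω),
      ((1 - v' (r y)) - (1 - v' (r x))) = 0 := by
  -- adapted from `SymmetricSlab.reflect_harmonic` (Theorems/PercGamblersRuinSymmetricSlabCalibration.lean)
  have h := hharm' (r x) (hrS x hx)
  have hsum : ∑ y ∈ ((zdGraph 3).neighborFinset x).filter (fun y => s(x, y) ∈ ω),
      (v' (r y) - v' (r x)) =
      ∑ y ∈ ((zdGraph 3).neighborFinset (r x)).filter
        (fun y => s(r x, y) ∈ BondConfig.relabel (sym2Equiv r) ω), (v' y - v' (r x)) := by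
    refine Finset.sum_equiv r (fun y => ?_) (fun y _ => rfl)
    simp only [Finset.mem_filter, SimpleGraph.mem_neighborFinset, hadj, mk_mem_relabel_iff]
  calc ∑ y ∈ ((zdGraph 3).neighborFinset x).filter (fun y => s(x, y) ∈ ω),
        ((1 - v' (r y)) - (1 - v' (r x)))
      = ∑ y ∈ ((zdGraph 3).neighborFinset x).filter (fun y => s(x, y) ∈ ω),
          (-(v' (r y) - v' (r x))) := Finset.sum_congr rfl (fun y _ => by ring)
    _ = -∑ y ∈ ((zdGraph 3).neighborFinset x).filter (fun y => s(x, y) ∈ ω),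
          (v' (r y) - v' (r x)) := Finset.sum_neg_distrib _
    _ = 0 := by rw [hsum, h, neg_zero]

/-- **Reflection identity for the lopsided slab.**  Let `A, L ≥ 1`, `r` a lattice automorphism of `ℤ³`
negating the height and fixing `0`, `R` the induced relabelling of configurations.  Let `v₁` carry the
plate values of the slab `(-A, L)` (`= 1` on `{x₀ ≥ L}`, `= 0` on `{x₀ ≤ -A}`) and be harmonic for the
open lattice edges of `ω` on `{-A < x₀ < L}`, and let `v₂` carry the plate values of the reflected slab
`(-L, A)` and be harmonic for the open lattice edges of `R ω` on `{-L < x₀ < A}`.  On the event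
"`ω ⊆ E(ℤ³)`, `|C(0)| = ∞`, `0` does not percolate using lattice steps inside `{-A < x₀ < L}`" one has
`v₁ 0 = 1 - v₂ 0`: both `v₁` and `x ↦ 1 - v₂ (r x)` are voltages of `(-A, L)` for `ω`, hence agree at
`0 = r 0` (`SymmetricSlab.eq_of_harmonic`). -/
theorem eq_one_sub_reflect {A L : ℕ} (hA : 0 < A) (hL : 0 < L) (r : Site 3 ≃ Site 3)
    (hr : ∀ x : Site 3, (r x) 0 = -(x 0)) (hr0 : r 0 = 0)
    (hadj : ∀ x y, (zdGraph 3).Adj (r x) (r y) ↔ (zdGraph 3).Adj x y)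
    {ω : BondConfig (Site 3)} {v₁ v₂ : Site 3 → ℝ}
    (htop₁ : ∀ x : Site 3, (L : ℤ) ≤ x 0 → v₁ x = 1)
    (hbot₁ : ∀ x : Site 3, x 0 ≤ -(A : ℤ) → v₁ x = 0)
    (hharm₁ : ∀ x : Site 3, -(A : ℤ) < x 0 → x 0 < (L : ℤ) →
      ∑ y ∈ ((zdGraph 3).neighborFinset x).filter (fun y => s(x, y) ∈ ω), (v₁ y - v₁ x) = 0)
    (htop₂ : ∀ x : Site 3, (A : ℤ) ≤ x 0 → v₂ x = 1)
    (hbot₂ : ∀ x : Site 3, x 0 ≤ -(L : ℤ) → v₂ x = 0)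
    (hharm₂ : ∀ x : Site 3, -(L : ℤ) < x 0 → x 0 < (A : ℤ) →
      ∑ y ∈ ((zdGraph 3).neighborFinset x).filter
        (fun y => s(x, y) ∈ BondConfig.relabel (sym2Equiv r) ω), (v₂ y - v₂ x) = 0)
    (hωE : ω ⊆ (zdGraph 3).edgeSet) (hinf : ω ∈ percolatesAt (0 : Site 3))
    (hfin : ω ∉ percolatesVia (withinGraph (zdGraph 3)
      {z : Site 3 | -(A : ℤ) < z 0 ∧ z 0 < (L : ℤ)}) (0 : Site 3)) :
    v₁ 0 = 1 - v₂ 0 := by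
  -- adapted from `SymmetricSlab.sum_reflect_eq_one` (Theorems/PercGamblersRuinSymmetricSlabCalibration.lean)
  have hfin' : (openClusterIn (withinGraph (zdGraph 3)
      {z : Site 3 | -(A : ℤ) < z 0 ∧ z 0 < (L : ℤ)}) ω 0).Finite := Set.not_infinite.1 hfin
  have h0 : (0 : Site 3) ∈ {z : Site 3 | -(A : ℤ) < z 0 ∧ z 0 < (L : ℤ)} := by
    simp only [Set.mem_setOf_eq, Pi.zero_apply]
    exact ⟨by omega, by omega⟩
  -- `r` maps the slab `(-A, L)` into the reflected slab `(-L, A)`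
  have hrS : ∀ x ∈ {z : Site 3 | -(A : ℤ) < z 0 ∧ z 0 < (L : ℤ)},
      r x ∈ {z : Site 3 | -(L : ℤ) < z 0 ∧ z 0 < (A : ℤ)} := by
    intro x hx
    simp only [Set.mem_setOf_eq, hr] at hx ⊢
    exact ⟨by omega, by omega⟩
  -- boundary values: the two candidate voltages agree off the open slab
  have hbdry : ∀ y : Site 3, y ∉ {z : Site 3 | -(A : ℤ) < z 0 ∧ z 0 < (L : ℤ)} →
      v₁ y = 1 - v₂ (r y) := by
    intro y hy
    simp only [Set.mem_setOf_eq, not_and_or, not_lt] at hy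
    rcases hy with hy | hy
    · rw [hbot₁ y hy, htop₂ (r y) (by rw [hr]; omega), sub_self]
    · rw [htop₁ y hy, hbot₂ (r y) (by rw [hr]; omega), sub_zero]
  have hh₁ : ∀ x ∈ {z : Site 3 | -(A : ℤ) < z 0 ∧ z 0 < (L : ℤ)},
      ∑ y ∈ ((zdGraph 3).neighborFinset x).filter (fun y => s(x, y) ∈ ω), (v₁ y - v₁ x) = 0 :=
    fun x hx => hharm₁ x hx.1 hx.2
  have hh' : ∀ x ∈ {z : Site 3 | -(L : ℤ) < z 0 ∧ z 0 < (A : ℤ)},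
      ∑ y ∈ ((zdGraph 3).neighborFinset x).filter
        (fun y => s(x, y) ∈ BondConfig.relabel (sym2Equiv r) ω), (v₂ y - v₂ x) = 0 :=
    fun x hx => hharm₂ x hx.1 hx.2
  have hh₂ := reflect_harmonic_of_mapsTo r hrS hadj hh'
  have h := SymmetricSlab.eq_of_harmonic (v₁ := v₁) (v₂ := fun x => 1 - v₂ (r x))
    h0 hωE hinf hfin' hbdry hh₁ hh₂
  simp only [hr0] at h
  exact h

/-! ### The weight `deg` and the bad event under the reflection -/

/-- **The number of open edges at the origin is reflection invariant.**  For a lattice automorphism `r`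
fixing `0` and `R = BondConfig.relabel (sym2Equiv r)`: `deg_{Rω}(0) = deg_ω(0)` (`y ↦ r y` is a bijection
from the open neighbours of `0` in `ω` onto those in `R ω`, `mk_mem_relabel_iff`). -/
theorem card_filter_relabel (r : Site 3 ≃ Site 3) (hr0 : r 0 = 0)
    (hadj : ∀ x y, (zdGraph 3).Adj (r x) (r y) ↔ (zdGraph 3).Adj x y) (ω : BondConfig (Site 3)) :
    (((zdGraph 3).neighborFinset (0 : Site 3)).filter
        (fun y => s((0 : Site 3), y) ∈ BondConfig.relabel (sym2Equiv r) ω)).card =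
      (((zdGraph 3).neighborFinset (0 : Site 3)).filter (fun y => s((0 : Site 3), y) ∈ ω)).card := by
  symm
  refine Finset.card_equiv r (fun y => ?_)
  have h1 := hadj 0 y
  have h2 := mk_mem_relabel_iff r ω 0 y
  rw [hr0] at h1 h2
  simp only [Finset.mem_filter, SimpleGraph.mem_neighborFinset, h1, h2]

/-- **BGN kill for the lopsided slab.**  Almost surely (for `P_{p_c}`) the origin does not percolate using
lattice steps inside the open slab `{-A < x₀ < L}` (`A, L : ℕ`): the slab step graph is below the step
graph of the half-space `{-A ≤ x₀}`, which contains `0` and does not percolate at `p_c(ℤ³)` from any of its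
points (`FreeBoxSparse.StubCeiling.real_percolatesVia_halfSpace_depth`, from the tree's proved
Barsky–Grimmett–Newman theorem). -/
theorem ae_not_percolatesVia_lopsidedSlab (A L : ℕ) :
    ∀ᵐ ω ∂(bondPercolation (zdGraph 3) (criticalProbI 3)),
      ω ∉ percolatesVia (withinGraph (zdGraph 3)
        {z : Site 3 | -(A : ℤ) < z 0 ∧ z 0 < (L : ℤ)}) (0 : Site 3) := by
  -- adapted from `StubBadSetMassOfMin.slab_percolatesVia_null` / `ae_not_percolatesVia_slab`
  have hsub : percolatesVia (withinGraph (zdGraph 3)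
      {z : Site 3 | -(A : ℤ) < z 0 ∧ z 0 < (L : ℤ)}) (0 : Site 3) ⊆
      percolatesVia (withinGraph (zdGraph 3) {y : Site 3 | -(A : ℤ) ≤ y 0}) (0 : Site 3) :=
    percolatesVia_mono_graph (withinGraph_mono (zdGraph 3) (fun z hz => by
      simp only [Set.mem_setOf_eq] at hz ⊢
      omega)) (0 : Site 3)
  have hnull : bondPercolation (zdGraph 3) (criticalProbI 3)
      (percolatesVia (withinGraph (zdGraph 3) {y : Site 3 | -(A : ℤ) ≤ y 0}) (0 : Site 3)) = 0 :=
    (measureReal_eq_zero_iff (by finiteness)).1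
      (FreeBoxSparse.StubCeiling.real_percolatesVia_halfSpace_depth (-(A : ℤ)) (0 : Site 3) (by
        simp only [Pi.zero_apply]
        omega))
  rw [← measure_eq_zero_iff_ae_notMem]
  exact measure_mono_null hsub hnull

end StubReflectedComplement

open SymmetricSlab StubReflectedComplement in
/-- **stub `stub_reflectedComplement` of line `registered` (crux `VerticalGamblersRuin`,
stmt-CriticalPhenomena-10642; skeleton rev 7): the reflected lopsided voltage is the complementary exit
mass.**  For `K, n ≥ 1`, a selection `v` of voltages of `(-Kn, (K+1)n)` and a selection `w` of voltages
of `(-(K+1)n, Kn)` (plate values and harmonicity for every `ω`; both measurable at `0`):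
`∫_{0↔∞} deg_ω(0) · w(ω,0) dP_{p_c} = ∫_{0↔∞} deg_ω(0) · (1 - v(ω,0)) dP_{p_c}`.
The reflection `r : x₀ ↦ -x₀` fixes `0`, preserves `P_{p_c}`, `{0↔∞}` and `deg_·(0)`, so
`∫_{0↔∞} deg·w(ω,0) = ∫_{0↔∞} deg·w(Rω,0)`; and a.s. on `{0↔∞}` (`ω ⊆ E(ℤ³)`, slab piece of
`(-Kn,(K+1)n)` finite by BGN) `w(Rω, 0) = 1 - v(ω, 0)` (`eq_one_sub_reflect`). -/
theorem stub_reflectedComplement :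
    ∀ (K n : ℕ), 0 < K → 0 < n →
      ∀ v : BondConfig (Site 3) → Site 3 → ℝ, Measurable (fun ω => v ω 0) →
        (∀ ω, (∀ x, 0 ≤ v ω x ∧ v ω x ≤ 1) ∧
          (∀ x : Site 3, (((K + 1) * n : ℕ) : ℤ) ≤ x 0 → v ω x = 1) ∧
          (∀ x : Site 3, x 0 ≤ -((K * n : ℕ) : ℤ) → v ω x = 0) ∧
          ∀ x : Site 3, -((K * n : ℕ) : ℤ) < x 0 → x 0 < (((K + 1) * n : ℕ) : ℤ) →
            ∑ y ∈ ((zdGraph 3).neighborFinset x).filter (fun y => s(x, y) ∈ ω), (v ω y - v ω x) = 0) →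
      ∀ w : BondConfig (Site 3) → Site 3 → ℝ, Measurable (fun ω => w ω 0) →
        (∀ ω, (∀ x, 0 ≤ w ω x ∧ w ω x ≤ 1) ∧
          (∀ x : Site 3, ((K * n : ℕ) : ℤ) ≤ x 0 → w ω x = 1) ∧
          (∀ x : Site 3, x 0 ≤ -(((K + 1) * n : ℕ) : ℤ) → w ω x = 0) ∧
          ∀ x : Site 3, -(((K + 1) * n : ℕ) : ℤ) < x 0 → x 0 < ((K * n : ℕ) : ℤ) →
            ∑ y ∈ ((zdGraph 3).neighborFinset x).filter (fun y => s(x, y) ∈ ω), (w ω y - w ω x) = 0) →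
        ∫ ω in percolatesAt (0 : Site 3),
            ((((zdGraph 3).neighborFinset (0 : Site 3)).filter
                (fun y => s((0 : Site 3), y) ∈ ω)).card : ℝ) * w ω 0
            ∂(bondPercolation (zdGraph 3) (criticalProbI 3)) =
          ∫ ω in percolatesAt (0 : Site 3),
            ((((zdGraph 3).neighborFinset (0 : Site 3)).filter
                (fun y => s((0 : Site 3), y) ∈ ω)).card : ℝ) * (1 - v ω 0)
            ∂(bondPercolation (zdGraph 3) (criticalProbI 3)) := by
  intro K n hK hn v _hvmeas hvsol w _hwmeas hwsol
  -- the reflection `x₀ ↦ -x₀`: height-negating, fixes `0`, lattice automorphism, preserves `P_{p_c}`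
  -- (adapted from `StubCoreOfVGR.setIntegral_symm_eq`)
  obtain ⟨r, hr, hr0, hadj, hmap⟩ : ∃ r : Site 3 ≃ Site 3, (∀ x : Site 3, (r x) 0 = -(x 0)) ∧
      r 0 = 0 ∧ (∀ x y, (zdGraph 3).Adj (r x) (r y) ↔ (zdGraph 3).Adj x y) ∧
      Measure.map (BondConfig.relabel (sym2Equiv r)) (bondPercolation (zdGraph 3) (criticalProbI 3)) =
        bondPercolation (zdGraph 3) (criticalProbI 3) :=
    ⟨Site.signedPerm (d := 3) (Equiv.refl (Fin 3)) (Function.update 1 0 (-1)), refl_apply_zero,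
      Site.signedPerm_zero _ _, adj_refl_iff,
      bondPercolation_map_relabel_iso
        (zdSignedPermIso (d := 3) (Equiv.refl (Fin 3)) (Function.update 1 0 (-1))) (criticalProbI 3)⟩
  set P := bondPercolation (zdGraph 3) (criticalProbI 3) with hPdef
  have hmp : MeasurePreserving (BondConfig.relabel (sym2Equiv r)) P P :=
    ⟨(BondConfig.relabel (sym2Equiv r)).measurable, hmap⟩
  -- `{0 ↔ ∞}` is `R`-invariant
  have hpre : BondConfig.relabel (sym2Equiv r) ⁻¹' (percolatesAt (0 : Site 3) : Set (BondConfig (Site 3))) =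
      percolatesAt (0 : Site 3) := by
    ext ω
    have h := relabel_mem_percolatesAt_iff r ω 0
    rw [hr0] at h
    exact h
  -- `∫_{0↔∞} deg_{Rω}(0) w(Rω,0) dP = ∫_{0↔∞} deg_ω(0) w(ω,0) dP`
  have hswap : ∫ ω in percolatesAt (0 : Site 3),
      ((((zdGraph 3).neighborFinset (0 : Site 3)).filter
        (fun y => s((0 : Site 3), y) ∈ BondConfig.relabel (sym2Equiv r) ω)).card : ℝ) *
          w (BondConfig.relabel (sym2Equiv r) ω) 0 ∂P =
      ∫ ω in percolatesAt (0 : Site 3),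
        ((((zdGraph 3).neighborFinset (0 : Site 3)).filter
          (fun y => s((0 : Site 3), y) ∈ ω)).card : ℝ) * w ω 0 ∂P := by
    have h := hmp.setIntegral_preimage_emb (BondConfig.relabel (sym2Equiv r)).measurableEmbedding
      (fun ω => ((((zdGraph 3).neighborFinset (0 : Site 3)).filter
        (fun y => s((0 : Site 3), y) ∈ ω)).card : ℝ) * w ω 0) (percolatesAt (0 : Site 3))
    rw [hpre] at h
    exact h
  rw [← hswap]
  -- a.s. on `{0 ↔ ∞}`: `deg_{Rω}(0) = deg_ω(0)` and `w(Rω,0) = 1 - v(ω,0)`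
  refine setIntegral_congr_ae (measurableSet_percolatesAt_holds 0) ?_
  have hE : ∀ᵐ ω ∂P, ω ⊆ (zdGraph 3).edgeSet := ProbabilityTheory.setBernoulli_ae_subset
  filter_upwards [hE, ae_not_percolatesVia_lopsidedSlab (K * n) ((K + 1) * n)] with ω hωE hfin hperc
  rw [card_filter_relabel r hr0 hadj ω,
    eq_one_sub_reflect (A := K * n) (L := (K + 1) * n) (v₁ := v ω)
      (v₂ := w (BondConfig.relabel (sym2Equiv r) ω)) (Nat.mul_pos hK hn)
      (Nat.mul_pos (Nat.succ_pos K) hn) r hr hr0 hadj (hvsol ω).2.1 (hvsol ω).2.2.1 (hvsol ω).2.2.2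
      (hwsol _).2.1 (hwsol _).2.2.1 (hwsol _).2.2.2 hωE hperc hfin,
    sub_sub_cancel]

end Summit.CriticalPhenomena.PercolationContinuityZ3.Theorems.VerticalGamblersRuin

end
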